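/-
Copyright (c) 2026 the pub-hodgecm-mathlib formalisation cell (harness21).  Prover seat hodgecm-mathlib-F0P3-p01 (g31), «(D-RAM) FOUR-FRAME» road of crux H413, line LH4, MS ROAD A,
STAGE B ∕ B56₂ (G-socket₂ assembly, dealer WORD #26 (2)): F1₂ «THE TYPE-2 STRATUM `(2ρ+1, 2ρ+1+s, 2ρ+1+s)` IS THE GLUED ∕ ROOT-GLUED HNF FRAME SET».  2026-09-04.
-/
import Summits.HodgeConjecture.HodgeConjecture.Theorems.F0P3cDyRamDiagonalStrataShapesTypeTwo   -- ★ (LH4-p04 (g2)) B3₂: `typeTwo_sieve`, the X-kills, `hasAxis_latt_hnf_of_exponents(_zero)`; brings ★ StrataDefs ED. 2 (`stratumTwo`), ★ HNF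
import HarnessLib

/-!
# Crux `H413`, MS ROAD A, STAGE B ∕ B56₂ sub-lemma F1₂: the type-2 stratum of axis vector `(2ρ+1, 2ρ+1+s, 2ρ+1+s)` is the set of GLUED (ρ ≥ 1) ∕ ROOT-GLUED (ρ = 0) HNF lattices

Cell `hodgecm-mathlib` (D-0151), FLOOR 0, crux item H413 = `stmt-HodgeConjecture-24833`; lane `--supports stmt-HodgeConjecture-24833 --as helper` (count-neutral).  THEOREMS ONLY
(no `def`, no instance, no notation, no `sorry`).  The type-2 twin of ★ p856131 `F0P3cDyRamDiagonalGluedStratum` (this seat), for the G-socket₂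
`∑ᶠ M ∈ stratumTwo σ ϖ T ![2ρ+1, 2ρ+1+s, 2ρ+1+s], polarisationCount·stabiliserWeight` (dealer WORD #26 (2); `stratumTwo` = ★ StrataDefs ED. 2).  Pure shape bookkeeping on LH4-p04 (g2)'s
★ B3₂ table (`typeTwo_sieve` + the eleven residual kills + `hasAxis_latt_hnf_of_exponents(_zero)` + `hasAxis_unique`), exactly as ★ `hasAxis_shapes_typeTwo` but KEEPING the HNF
letters of the surviving family `G₁(2ρ+1, s)` (MEMO v2.1 §T2.1): `b = ρ`, `c = 2ρ+1+s`, `|z| = |ϖ|^ρ`, `|xz − yϖ^ρ| = |ϖ|^{ρ+s}`, `s ≥ 2` even, and `|x| = |y| = 1` when `ρ ≥ 1`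
(`exists_hnf_of_mem_stratumTwo_G1`).  Heads: **`stratumTwo_G1_eq`** (ρ ≥ 1, glued letters `ζ := z∕ϖ^ρ`, `y″ := y − xζ`: frame `(1 0 0; x ϖ^ρ 0; xζ+y″ ϖ^ρζ ϖ^{2ρ+1+s})` — the
frame of ★ p856270 (LH4-p09 (g2)) and of ★ p856076∕p856198∕p856228∕p856265∕p856276 (this seat)); **`stratumTwo_G1_zero_eq`** (ρ = 0, root letters `(1 0 0; 0 1 0; y−xz z ϖ^{1+s})` — the
frame of ★ p856303 (p09) and ★ p856296 (this seat)); `two_dvd_of_mem_stratumTwo_G1` ∕ `stratumTwo_G1_eq_empty_of_odd` (odd `s` ⇒ empty).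
HONEST LABEL.  Count-neutral (`--supports`); the census laws (MS) stay PROVER TARGETS until the re-keyed B10₂ assembly lands; `HC_CM` is proved only modulo the 7 printed citations
(2 remaining named inputs: hLiu418 = `stmt-HodgeConjecture-24832`, h413 = `stmt-HodgeConjecture-24833`) until rung 0 closes.

## References
* [Kottwitz1986BaseChangeUnits] R. E. Kottwitz, *Base change for unit elements of Hecke algebras*, Compositio Math. 60 (1986), §1 pp. 240–241 (fixed-lattice counting by position).
* [Serre1980Trees] J.-P. Serre, *Trees*, Springer (1980), Ch. II §1.1 (lattices `g·𝒪^N`, Hermite normal forms, coordinate axes).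
* [Jacobowitz1962] R. Jacobowitz, *Hermitian forms over local fields*, Amer. J. Math. 84 (1962), §7–§8 (`𝔭`-modular lattices).
-/

set_option autoImplicit false

noncomputable section

namespace Summit.HodgeConjecture.HodgeConjecture.Cruxes.H413.F0P3cDyRamDiagonalGluedStratumTwo

open Matrix
open Literature.NumberTheory.Automorphic Literature.NumberTheory.Automorphic.HermitianLattice
open Literature.NumberTheory.Automorphic.UnitaryLatticeTree
open Summit.HodgeConjecture.HodgeConjecture.Cruxes.H413.F0P3cDyRamDiagonalTorusDefs
open Summit.HodgeConjecture.HodgeConjecture.Cruxes.H413.F0P3cDyRamDiagonalStrataDefs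
open Summit.HodgeConjecture.HodgeConjecture.Cruxes.H413.F0P3cDyRamDiagonalStableLatticeHNF
open Summit.HodgeConjecture.HodgeConjecture.Cruxes.H413.F0P3cDyRamDiagonalStableLatticeHNFExists
open Summit.HodgeConjecture.HodgeConjecture.Cruxes.H413.F0P3cDyRamDiagonalStrataAxis
open Summit.HodgeConjecture.HodgeConjecture.Cruxes.H413.F0P3cDyRamDiagonalStrataShapes
open Summit.HodgeConjecture.HodgeConjecture.Cruxes.H413.F0P3cDyRamDiagonalHNFAxisOfExponents
open Summit.HodgeConjecture.HodgeConjecture.Cruxes.H413.F0P3cDyRamDiagonalDualisableStrataTypeTwoSieve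
open Summit.HodgeConjecture.HodgeConjecture.Cruxes.H413.F0P3cDyRamDiagonalTypeTwoExclX1
open Summit.HodgeConjecture.HodgeConjecture.Cruxes.H413.F0P3cDyRamDiagonalTypeTwoExclColumnOne
open Summit.HodgeConjecture.HodgeConjecture.Cruxes.H413.F0P3cDyRamDiagonalTypeTwoExclX3467
open Summit.HodgeConjecture.HodgeConjecture.Cruxes.H413.F0P3cDyRamDiagonalTypeTwoExclX59
open scoped Valued WithZero Matrix MatrixGroups

variable {K : Type*} [Field K] [Valued K ℤᵐ⁰]

/-- **(⊆) A MEMBER OF THE TYPE-2 STRATUM `(2ρ+1, 2ρ+1+s, 2ρ+1+s)` (`s ≥ 1`) IS A `G₁(2ρ+1, s)` HNF LATTICE**: `M = (1 0 0; x ϖ^ρ 0; y z ϖ^{2ρ+1+s})·𝒪³` with `|z| = |ϖ^ρ|`,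
`|xz − yϖ^ρ| = |ϖ^{ρ+s}|`, `s ≥ 2` EVEN, `|x| ≤ 1`, `|y| ≤ 1`, and `|x| = |y| = 1` if `ρ ≥ 1` (★ HNF + ★ B3₂ `typeTwo_sieve` + the eleven ★ kills + ★ axis vectors + ★ `hasAxis_unique`).
[cite: Kottwitz1986BaseChangeUnits, §1 pp. 240–241] [cite: Serre1980Trees, Ch. II §1.1] [cite: Jacobowitz1962, §7–§8] -/
theorem exists_hnf_of_mem_stratumTwo_G1 {σ : K →+* K} (hvσ : ∀ a, Valued.v (σ a) = Valued.v a)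
    (hfix : ∀ x : K, σ x = x → x ≠ 0 → ∃ n : ℤ, Valued.v x = WithZero.exp (2 * n)) {ϖ : K} (hϖ : Valued.v ϖ = WithZero.exp (-1 : ℤ))
    (T : GL (Fin 3) K) {ρ s : ℕ} (hs : 1 ≤ s) {M : Submodule 𝒪[K] (Fin 3 → K)} (hM : M ∈ stratumTwo σ ϖ T ![2 * ρ + 1, 2 * ρ + 1 + s, 2 * ρ + 1 + s]) :
    ∃ x y z : K, Valued.v x ≤ 1 ∧ Valued.v y ≤ 1 ∧ (1 ≤ ρ → Valued.v x = 1 ∧ Valued.v y = 1) ∧ Valued.v z = Valued.v (ϖ ^ ρ) ∧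
      Valued.v (x * z - y * ϖ ^ ρ) = Valued.v (ϖ ^ (ρ + s)) ∧ 2 ∣ s ∧ 2 ≤ s ∧
      M = latt (Matrix.of ![![1, 0, 0], ![x, ϖ ^ ρ, 0], ![y, z, ϖ ^ (2 * ρ + 1 + s)]]) ∧ mapGL T M = M ∧ IsTypeTwoPolarisable σ ϖ M := by
  obtain ⟨hM0, hpol0, ha⟩ := (mem_stratumTwo_iff σ ϖ T _ M).1 hM
  obtain ⟨⟨g, rfl⟩, hT, hnorm⟩ := hM0
  have hq : ∀ n : ℕ, Valued.v (ϖ ^ n) = WithZero.exp (-(n : ℤ)) := fun n => by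
    rw [map_pow, hϖ, ← WithZero.exp_nsmul]; congr 1; simp
  have hq1 : ∀ n : ℕ, Valued.v (ϖ ^ n) ≤ 1 := fun n => by rw [hq, ← WithZero.exp_zero, WithZero.exp_le_exp]; omega
  have hq_eq_one : ∀ n : ℕ, Valued.v (ϖ ^ n) = 1 → n = 0 := fun n h => by
    rw [hq, ← WithZero.exp_zero, WithZero.exp_inj] at h; omega
  -- the HNF model
  have hle : latt (g : Matrix (Fin 3) (Fin 3) K) ≤ stdLattice K 3 := fun w hw => mem_stdLattice.2 fun i => (hnorm i).1 w hw
  obtain ⟨b, c, x, y, z, hx, hy, hz, hV⟩ := exists_latt_eq_latt_hnf hϖ g hle (hnorm 0).2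
  rw [hV] at hnorm hpol0 ha hT ⊢
  have hpol := (isTypeTwoPolarisable_iff σ ϖ _).1 hpol0
  have hN := (normalised_latt_hnf_iff hx hy hz (hq1 b) (hq1 c)).1 hnorm
  have hxb : 1 ≤ b → Valued.v x = 1 := fun hb => hN.1.resolve_left fun h => by have := hq_eq_one b h; omega
  -- reading a candidate axis vector against `(2ρ+1, 2ρ+1+s, 2ρ+1+s)`
  have hax : ∀ {a' : Fin 3 → ℕ}, HasAxis ϖ (latt (Matrix.of ![![1, 0, 0], ![x, ϖ ^ b, 0], ![y, z, ϖ ^ c]])) a' →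
      a' 0 = 2 * ρ + 1 ∧ a' 1 = 2 * ρ + 1 + s ∧ a' 2 = 2 * ρ + 1 + s := fun ha' => by
    have h := hasAxis_unique hϖ ha' ha
    rw [h]; simp
  rcases typeTwo_sieve hvσ hfix hϖ b c hx hy hz hnorm hpol with
    ⟨hc, hb⟩ | ⟨hb, hc, hz1, hw⟩ | ⟨hb, hc, hc3, hz1, hw⟩ | ⟨hb, hc, hz1, hw⟩ | ⟨hb, hc, hzc, hy1⟩ | ⟨hb, hc, hc3, hzm, hy1⟩ |
    ⟨hb1, hc, hcb, hzm, hy1, hw⟩ | ⟨hb1, hc, hzm, hy1, hw⟩ | ⟨hb1, hc, hcb, hzm, hy1⟩ | ⟨m, hmb, hc, hp, hzm, hy1⟩ |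
    hX | hX | hX | hX | hX | hX | hX | hX | hX | hX | hX
  · -- T₃ `(b, b, 0)`
    exfalso; subst c
    have h := (hax (hasAxis_latt_hnf_T3 hϖ b (hxb (by omega)) hy hz)).2.2
    simp at h; omega
  · -- T₁ `(0, c, c)`
    exfalso; subst b
    rw [pow_zero, mul_one, Valuation.map_sub_swap] at hw
    have h := (hax (hasAxis_latt_hnf_T1 hϖ c hx hz1 hw)).1
    simp at h
  · -- G₁(1, c−1) `(1, c, c)`: THE ρ = 0 CASE
    subst b
    have hz0 : Valued.v z = Valued.v (ϖ ^ 0) := by rw [pow_zero, map_one]; exact hz1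
    obtain ⟨h0, h1, -⟩ := hax (hasAxis_latt_hnf_of_exponents_zero hϖ c hx hz0 hw)
    simp at h0 h1
    have hρ0 : ρ = 0 := by omega
    have hcs : c = 2 * ρ + 1 + s := by omega
    subst hρ0; subst hcs
    refine ⟨x, y, z, hx, hy, fun h => absurd h (by omega), hz0, ?_, by omega, by omega, rfl, hT, hpol0⟩
    rw [hw]; congr 2; omega
  · -- H(1) `(1,1,1)`
    exfalso; subst b; subst c
    have hz0 : Valued.v z = Valued.v (ϖ ^ 0) := by rw [pow_zero, map_one]; exact hz1
    have hw0 : Valued.v (x * z - y * ϖ ^ 0) = Valued.v (ϖ ^ 0) := by rw [hw, pow_zero, map_one]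
    have h := (hax (hasAxis_latt_hnf_of_exponents_zero hϖ 1 hx hz0 hw0)).2.1
    simp at h; omega
  · -- T₂ `(c, 0, c)`
    exfalso; subst b
    have h := (hax (hasAxis_latt_hnf_T2 hϖ (by omega) hx hzc hy1)).2.1
    simp at h; omega
  · -- G₂(1, c−1) `(c, 1, c)`
    exfalso; subst b
    have hw0 : Valued.v (x * z - y * ϖ ^ 0) = Valued.v (ϖ ^ 0) := by
      rw [pow_zero, mul_one, Valuation.map_sub_eq_of_lt_right _ ?_, hy1, map_one]
      rw [hy1, map_mul, hzm, hq]
      calc Valued.v x * WithZero.exp (-((c - 1 : ℕ) : ℤ)) ≤ 1 * WithZero.exp (-((c - 1 : ℕ) : ℤ)) := mul_le_mul' hx le_rfl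
        _ < 1 := by rw [one_mul, ← WithZero.exp_zero, WithZero.exp_lt_exp]; omega
    have h := (hax (hasAxis_latt_hnf_of_exponents_zero hϖ c hx hzm hw0)).2.1
    simp at h; omega
  · -- G₁ `(2b+1, c, c)`: THE ρ ≥ 1 CASE
    obtain ⟨h0, h1, -⟩ := hax (hasAxis_latt_hnf_of_exponents hϖ b c (hxb hb1) hzm hw)
    simp at h0 h1
    have hbρ : b = ρ := by omega
    have hcs : c = 2 * ρ + 1 + s := by omega
    subst hbρ; subst hcs
    refine ⟨x, y, z, hx, hy, fun _ => ⟨hxb hb1, hy1⟩, hzm, ?_, by omega, by omega, rfl, hT, hpol0⟩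
    rw [hw]; congr 2; omega
  · -- H `(c, c, c)`
    exfalso
    obtain ⟨h0, h1, -⟩ := hax (hasAxis_latt_hnf_of_exponents hϖ b c (hxb hb1) hzm hw)
    simp at h0 h1; omega
  · -- G₂ `(c, 2b+1, c)`
    exfalso
    have hx1 := hxb hb1
    have hw : Valued.v (x * z - y * ϖ ^ b) = Valued.v (ϖ ^ b) := by
      rw [Valuation.map_sub_eq_of_lt_right _ ?_, map_mul, hy1, one_mul]
      rw [map_mul, hx1, one_mul, hzm, hq, map_mul, hy1, one_mul, hq, WithZero.exp_lt_exp]; omega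
    obtain ⟨h0, h1, -⟩ := hax (hasAxis_latt_hnf_of_exponents hϖ b c hx1 hzm hw)
    simp at h0 h1; omega
  · -- G₃ `(b+m+1, b+m+1, 2m+1)`
    exfalso
    have hx1 := hxb (by omega)
    have hw : Valued.v (x * z - y * ϖ ^ b) = Valued.v (ϖ ^ m) := by
      rw [Valuation.map_sub_eq_of_lt_left _ ?_, map_mul, hx1, one_mul, hzm]
      rw [map_mul, map_mul, hx1, one_mul, hzm, hq, hq]
      calc Valued.v y * WithZero.exp (-(b : ℤ)) ≤ 1 * WithZero.exp (-(b : ℤ)) := mul_le_mul' hy le_rfl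
        _ < WithZero.exp (-(m : ℤ)) := by rw [one_mul, WithZero.exp_lt_exp]; omega
    obtain ⟨h0, h1, -⟩ := hax (hasAxis_latt_hnf_of_exponents hϖ b c hx1 hzm hw)
    simp at h0 h1; omega
  -- the eleven residual families are not type-2 polarisable (★ kills, verbatim as in `hasAxis_shapes_typeTwo`)
  · obtain ⟨hb2, hbe, hc, hzc, hy1, hwc⟩ := hX
    exact (not_typeTwoPolarisable_X1 hvσ hfix hϖ hx hy hz hnorm hb2 hbe hc hzc hy1 hwc hpol).elim
  · obtain ⟨hb, hce, hcb, hzc, -, hw⟩ := hX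
    exact (not_typeTwoPolarisable_X2 hvσ hfix hϖ hx hy hz hnorm hb hce hcb hzc hw hpol).elim
  · exact (typeTwo_exclX3 hvσ hfix hϖ b c hx hy hz hnorm hpol hX).elim
  · exact (typeTwo_exclX4 hvσ hfix hϖ b c hx hy hz hnorm hpol hX).elim
  · exact (typeTwo_exclX5 hvσ hfix hϖ b c hx hy hz hnorm hpol hX).elim
  · exact (typeTwo_exclX6 hvσ hfix hϖ b c hx hy hz hnorm hpol hX).elim
  · exact (typeTwo_exclX7 hvσ hfix hϖ b c hx hy hz hnorm hpol hX).elim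
  · obtain ⟨m, hm3, hmb, hc, hp, hzm, hy1⟩ := hX
    exact (not_typeTwoPolarisable_X8 hvσ hfix hϖ hx hy hz hnorm hm3 hmb hc hp hzm hy1 hpol).elim
  · exact (typeTwo_exclX9 hvσ hfix hϖ b c hx hy hz hnorm hpol hX).elim
  · obtain ⟨hb1, hce, hbc, hzb, hy1, h⟩ := hX
    rcases h with ⟨hb, hwc⟩ | ⟨hb2, hcb, hw⟩
    · exact (not_typeTwoPolarisable_X10a_X11a hvσ hfix hϖ hx hy hz hnorm (Or.inl hb) hce (by omega) hzb hwc hpol).elim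
    · exact (not_typeTwoPolarisable_X10b_X11b hvσ hfix hϖ hx hy hz hnorm hce hzb hy1 (k := 1) (Or.inl rfl) (by omega) (by omega) hw hpol).elim
  · obtain ⟨hb2, hce, hbc, hzb, hy1, h⟩ := hX
    rcases h with ⟨hb, hwc⟩ | ⟨hb3, hcb, hw⟩
    · exact (not_typeTwoPolarisable_X10a_X11a hvσ hfix hϖ hx hy hz hnorm (Or.inr hb) hce (by omega) hzb hwc hpol).elim
    · exact (not_typeTwoPolarisable_X10b_X11b hvσ hfix hϖ hx hy hz hnorm hce hzb hy1 (k := 2) (Or.inr rfl) (by omega) (by omega) hw hpol).elim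

/-- **A MEMBER FORCES `s` EVEN (and `s ≥ 2`)**. [cite: Kottwitz1986BaseChangeUnits, §1 pp. 240–241] -/
theorem two_dvd_of_mem_stratumTwo_G1 {σ : K →+* K} (hvσ : ∀ a, Valued.v (σ a) = Valued.v a)
    (hfix : ∀ x : K, σ x = x → x ≠ 0 → ∃ n : ℤ, Valued.v x = WithZero.exp (2 * n)) {ϖ : K} (hϖ : Valued.v ϖ = WithZero.exp (-1 : ℤ))
    (T : GL (Fin 3) K) {ρ s : ℕ} (hs : 1 ≤ s) {M : Submodule 𝒪[K] (Fin 3 → K)} (hM : M ∈ stratumTwo σ ϖ T ![2 * ρ + 1, 2 * ρ + 1 + s, 2 * ρ + 1 + s]) :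
    2 ∣ s ∧ 2 ≤ s := by
  obtain ⟨-, -, -, -, -, -, -, -, h2s, hs2, -⟩ := exists_hnf_of_mem_stratumTwo_G1 hvσ hfix hϖ T hs hM
  exact ⟨h2s, hs2⟩

/-- **THE STRATUM IS EMPTY FOR ODD `s`**. [cite: Kottwitz1986BaseChangeUnits, §1 pp. 240–241] -/
theorem stratumTwo_G1_eq_empty_of_odd {σ : K →+* K} (hvσ : ∀ a, Valued.v (σ a) = Valued.v a)
    (hfix : ∀ x : K, σ x = x → x ≠ 0 → ∃ n : ℤ, Valued.v x = WithZero.exp (2 * n)) {ϖ : K} (hϖ : Valued.v ϖ = WithZero.exp (-1 : ℤ))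
    (T : GL (Fin 3) K) {ρ s : ℕ} (hs : ¬ 2 ∣ s) :
    stratumTwo σ ϖ T ![2 * ρ + 1, 2 * ρ + 1 + s, 2 * ρ + 1 + s] = ∅ :=
  Set.eq_empty_iff_forall_notMem.2 fun _ hM => hs (two_dvd_of_mem_stratumTwo_G1 hvσ hfix hϖ T (by omega) hM).1

/-- **ρ ≥ 1: THE TYPE-2 STRATUM `(2ρ+1, 2ρ+1+s, 2ρ+1+s)` IS THE GLUED FRAME SET** `{latt (1 0 0; x ϖ^ρ 0; xζ+y″ ϖ^ρζ ϖ^{2ρ+1+s}) : |x| = |ζ| = 1, |y″| = |ϖ|^s, T-stable, type-2 polarisable}`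
(glued letters `ζ = z∕ϖ^ρ`, `y″ = y − xζ`; `s ≥ 1`). [cite: Kottwitz1986BaseChangeUnits, §1 pp. 240–241] [cite: Serre1980Trees, Ch. II §1.1] -/
theorem stratumTwo_G1_eq {σ : K →+* K} (hvσ : ∀ a, Valued.v (σ a) = Valued.v a)
    (hfix : ∀ x : K, σ x = x → x ≠ 0 → ∃ n : ℤ, Valued.v x = WithZero.exp (2 * n)) {ϖ : K} (hϖ : Valued.v ϖ = WithZero.exp (-1 : ℤ))
    (T : GL (Fin 3) K) {ρ s : ℕ} (hρ : 1 ≤ ρ) (hs : 1 ≤ s) :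
    stratumTwo σ ϖ T ![2 * ρ + 1, 2 * ρ + 1 + s, 2 * ρ + 1 + s] =
      {M | ∃ x ζ y'' : K, Valued.v x = 1 ∧ Valued.v ζ = 1 ∧ Valued.v y'' = Valued.v ϖ ^ s ∧
        M = latt (!![1, 0, 0; x, ϖ ^ ρ, 0; x * ζ + y'', ϖ ^ ρ * ζ, ϖ ^ (2 * ρ + 1 + s)] : Matrix (Fin 3) (Fin 3) K) ∧ mapGL T M = M ∧ IsTypeTwoPolarisable σ ϖ M} := by
  have hϖ0 : ϖ ≠ 0 := (Valuation.ne_zero_iff Valued.v).1 (by rw [hϖ]; exact WithZero.exp_ne_zero)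
  have hvϖ : 0 < Valued.v ϖ := (Valuation.pos_iff _).2 hϖ0
  have hϖ1 : Valued.v ϖ < 1 := by rw [hϖ, ← WithZero.exp_zero, WithZero.exp_lt_exp]; norm_num
  have hq1 : ∀ n : ℕ, Valued.v (ϖ ^ n) ≤ 1 := fun n => by rw [map_pow]; exact pow_le_one₀ zero_le hϖ1.le
  have hpρ : Valued.v (ϖ ^ ρ) ≠ 0 := by rw [map_pow]; exact pow_ne_zero _ hvϖ.ne'
  ext M
  constructor
  · intro hM
    obtain ⟨x, y, z, -, -, hxy, hzρ, hw, -, -, rfl, hT, hpol⟩ := exists_hnf_of_mem_stratumTwo_G1 hvσ hfix hϖ T hs hM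
    obtain ⟨hx1, hy1⟩ := hxy hρ
    set ζ : K := z * (ϖ ^ ρ)⁻¹ with hζdef
    set y'' : K := y - x * ζ with hy''def
    have hzeq : ϖ ^ ρ * ζ = z := by rw [hζdef]; field_simp
    have hyeq : x * ζ + y'' = y := by rw [hy''def]; ring
    have hζ : Valued.v ζ = 1 := by rw [hζdef, map_mul, map_inv₀, hzρ, mul_inv_cancel₀ hpρ]
    have hy'' : Valued.v y'' = Valued.v ϖ ^ s := by
      have e : y'' = -((x * z - y * ϖ ^ ρ) * (ϖ ^ ρ)⁻¹) := by rw [hy''def, hζdef]; field_simp; ring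
      rw [e, Valuation.map_neg, map_mul, map_inv₀, hw, pow_add, map_mul, mul_assoc, mul_comm (Valued.v (ϖ ^ s)), ← mul_assoc,
        mul_inv_cancel₀ hpρ, one_mul, map_pow]
    refine ⟨x, ζ, y'', hx1, hζ, hy'', ?_, hT, hpol⟩
    rw [hyeq, hzeq]
  · rintro ⟨x, ζ, y'', hx1, hζ, hy'', rfl, hT, hpol⟩
    have hz : Valued.v (ϖ ^ ρ * ζ) = Valued.v (ϖ ^ ρ) := by rw [map_mul, hζ, mul_one]
    have hxζ : Valued.v (x * ζ) = 1 := by rw [map_mul, hx1, hζ, mul_one]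
    have hy1 : Valued.v (x * ζ + y'') = 1 := by
      rw [Valuation.map_add_eq_of_lt_left _ (by rw [hxζ, hy'']; exact pow_lt_one₀ zero_le hϖ1 (by omega)), hxζ]
    have hw : Valued.v (x * (ϖ ^ ρ * ζ) - (x * ζ + y'') * ϖ ^ ρ) = Valued.v (ϖ ^ (ρ + s)) := by
      rw [show x * (ϖ ^ ρ * ζ) - (x * ζ + y'') * ϖ ^ ρ = -(y'' * ϖ ^ ρ) by ring, Valuation.map_neg, map_mul, hy'', map_pow, map_pow, pow_add, mul_comm]
    have hdet : (!![1, 0, 0; x, ϖ ^ ρ, 0; x * ζ + y'', ϖ ^ ρ * ζ, ϖ ^ (2 * ρ + 1 + s)] : Matrix (Fin 3) (Fin 3) K).det ≠ 0 := by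
      rw [Matrix.det_fin_three]; simp [hϖ0]
    have hAx := hasAxis_latt_hnf_of_exponents hϖ ρ (2 * ρ + 1 + s) hx1 hz hw
    have hvec : (![ρ + (2 * ρ + 1 + s - (ρ + s)), ρ + (2 * ρ + 1 + s - ρ), 2 * ρ + 1 + s] : Fin 3 → ℕ) = ![2 * ρ + 1, 2 * ρ + 1 + s, 2 * ρ + 1 + s] := by
      ext i; fin_cases i <;> simp <;> omega
    rw [hvec] at hAx
    refine (mem_stratumTwo_iff σ ϖ T _ _).2 ⟨⟨⟨Matrix.GeneralLinearGroup.mkOfDetNeZero _ hdet, rfl⟩, hT, ?_⟩, hpol, hAx⟩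
    exact (normalised_latt_hnf_iff hx1.le hy1.le (by rw [hz]; exact hq1 ρ) (hq1 ρ) (hq1 _)).2 ⟨Or.inr hx1, Or.inr (Or.inl hy1)⟩

/-- **ρ = 0: THE TYPE-2 STRATUM `(1, 1+s, 1+s)` IS THE ROOT-GLUED FRAME SET** `{latt (1 0 0; 0 1 0; y ζ ϖ^{1+s}) : |ζ| = 1, |y| = |ϖ|^s, T-stable, type-2 polarisable}` (`s ≥ 1`; the HNF
`(1 0 0; x 1 0; y z ϖ^{1+s})` is the root frame `(1 0 0; 0 1 0; y−xz z ϖ^{1+s})` of the SAME lattice). [cite: Kottwitz1986BaseChangeUnits, §1 pp. 240–241] [cite: Serre1980Trees, Ch. II §1.1] -/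
theorem stratumTwo_G1_zero_eq {σ : K →+* K} (hvσ : ∀ a, Valued.v (σ a) = Valued.v a)
    (hfix : ∀ x : K, σ x = x → x ≠ 0 → ∃ n : ℤ, Valued.v x = WithZero.exp (2 * n)) {ϖ : K} (hϖ : Valued.v ϖ = WithZero.exp (-1 : ℤ))
    (T : GL (Fin 3) K) {s : ℕ} (hs : 1 ≤ s) :
    stratumTwo σ ϖ T ![2 * 0 + 1, 2 * 0 + 1 + s, 2 * 0 + 1 + s] =
      {M | ∃ y ζ : K, Valued.v ζ = 1 ∧ Valued.v y = Valued.v ϖ ^ s ∧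
        M = latt (!![1, 0, 0; 0, 1, 0; y, ζ, ϖ ^ (2 * 0 + 1 + s)] : Matrix (Fin 3) (Fin 3) K) ∧ mapGL T M = M ∧ IsTypeTwoPolarisable σ ϖ M} := by
  have hϖ0 : ϖ ≠ 0 := (Valuation.ne_zero_iff Valued.v).1 (by rw [hϖ]; exact WithZero.exp_ne_zero)
  have hvϖ : 0 < Valued.v ϖ := (Valuation.pos_iff _).2 hϖ0
  have hϖ1 : Valued.v ϖ < 1 := by rw [hϖ, ← WithZero.exp_zero, WithZero.exp_lt_exp]; norm_num
  have hq1 : ∀ n : ℕ, Valued.v (ϖ ^ n) ≤ 1 := fun n => by rw [map_pow]; exact pow_le_one₀ zero_le hϖ1.le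
  have h10 : (ϖ ^ 0 : K) ≠ 0 := by rw [pow_zero]; exact one_ne_zero
  have hr : (ϖ ^ (2 * 0 + 1 + s) : K) ≠ 0 := pow_ne_zero _ hϖ0
  ext M
  constructor
  · intro hM
    obtain ⟨x, y, z, hx, -, -, hz0, hw, -, -, rfl, hT, hpol⟩ := exists_hnf_of_mem_stratumTwo_G1 hvσ hfix hϖ T hs hM
    have hz1 : Valued.v z = 1 := by rw [hz0, pow_zero, map_one]
    rw [zero_add, pow_zero, mul_one] at hw
    have hyw : Valued.v (y - x * z) = Valued.v ϖ ^ s := by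
      rw [Valuation.map_sub_swap, hw, map_pow]
    -- the HNF frame and the root frame give the SAME lattice
    have heq : latt (Matrix.of ![![1, 0, 0], ![x, ϖ ^ 0, 0], ![y, z, ϖ ^ (2 * 0 + 1 + s)]]) =
        latt (Matrix.of ![![1, 0, 0], ![0, ϖ ^ 0, 0], ![y - x * z, z, ϖ ^ (2 * 0 + 1 + s)]]) := by
      rw [latt_hnf_eq_latt_hnf_iff _ _ _ _ _ _ h10 hr]
      refine ⟨by rw [sub_zero, pow_zero, map_one]; exact hx, by rw [sub_self, map_zero]; exact zero_le, ?_⟩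
      rw [show (y - (y - x * z)) * ϖ ^ 0 - z * (x - 0) = 0 by ring, map_zero]; exact zero_le
    refine ⟨y - x * z, z, hz1, hyw, ?_, hT, hpol⟩
    rw [heq, pow_zero]
  · rintro ⟨y, ζ, hζ, hy, rfl, hT, hpol⟩
    have hdet : (!![1, 0, 0; 0, 1, 0; y, ζ, ϖ ^ (2 * 0 + 1 + s)] : Matrix (Fin 3) (Fin 3) K).det ≠ 0 := by
      rw [Matrix.det_fin_three]; simp [hϖ0]
    have hz0 : Valued.v ζ = Valued.v (ϖ ^ 0) := by rw [pow_zero, map_one]; exact hζ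
    have hw : Valued.v (0 * ζ - y * ϖ ^ 0) = Valued.v (ϖ ^ s) := by rw [zero_mul, pow_zero, mul_one, zero_sub, Valuation.map_neg, hy, ← map_pow]
    have hAx := hasAxis_latt_hnf_of_exponents_zero hϖ (2 * 0 + 1 + s) (x := 0) (by rw [map_zero]; exact zero_le) hz0 hw
    have hfr : (Matrix.of ![![1, 0, 0], ![(0 : K), ϖ ^ 0, 0], ![y, ζ, ϖ ^ (2 * 0 + 1 + s)]] : Matrix (Fin 3) (Fin 3) K) = !![1, 0, 0; 0, 1, 0; y, ζ, ϖ ^ (2 * 0 + 1 + s)] := by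
      rw [pow_zero]
    have hvec : (![2 * 0 + 1 + s - s, 2 * 0 + 1 + s - 0, 2 * 0 + 1 + s] : Fin 3 → ℕ) = ![2 * 0 + 1, 2 * 0 + 1 + s, 2 * 0 + 1 + s] := by
      ext i; fin_cases i <;> simp
    rw [hfr, hvec] at hAx
    refine (mem_stratumTwo_iff σ ϖ T _ _).2 ⟨⟨⟨Matrix.GeneralLinearGroup.mkOfDetNeZero _ hdet, rfl⟩, hT, ?_⟩, hpol, hAx⟩
    exact (normalised_latt_hnf_iff (x := 0) (p := 1) (by rw [map_zero]; exact zero_le) (by rw [hy]; exact pow_le_one₀ zero_le hϖ1.le) hζ.le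
      (by rw [map_one]) (hq1 _)).2 ⟨Or.inl (map_one _), Or.inr (Or.inr hζ)⟩

end Summit.HodgeConjecture.HodgeConjecture.Cruxes.H413.F0P3cDyRamDiagonalGluedStratumTwo

end
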